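import Summits.BirchSwinnertonDyer.Rank1Residual.Supersingular.BlindPointFlatTwo
import Literature.NumberTheory.EllipticCurves.QuadraticTwist
import Literature.NumberTheory.EllipticCurves.BSDRootNumberSmallConductorProofs
import Literature.NumberTheory.EllipticCurves.Rank1Residual.Predicates
import Literature.NumberTheory.EllipticCurves.GlobalMinimalModel
import Literature.NumberTheory.EllipticCurves.FormalGroup
import Literature.NumberTheory.EllipticCurves.PadicFormalLogOrder
import Literature.NumberTheory.EllipticCurves.BSDInvariants
import HarnessLib

/-!
# -an g38 · P-an-42E — the blind flat unit MOD 32: the non-local bit is the square class of `log_ω(P₂)`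

Cell bsd-f1-sign2, seat -an (analytic / Waldspurger–Gross–Zagier lens), gen 38; crux
`ByReductionTypeAtTwo.RankOneAtTwoBigImageOddLocal` (stmt-BirchSwinnertonDyer-23715).

LAW 42C (`BlindFlatUnitKatzAN55.FlatBlindUnitFrobeniusAtChi8`) pins `unit(b)·m₂₁ mod 16` by local
data (`−2·Tam(E₂)_odd`).  One bit higher the unit is NOT local: on the 1085 census rows with ≥ 4
certified unit bits and `m₂₁ = ⟨ω, φω⟩` known mod 32 (kit j341036), `unit(b)·m₂₁/(−2·Tam_odd) mod 16`
takes the two values 1 and 9 ≈ 50:50 in every `a₂` class (CensusAN43 §8).  The transplanted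
Kobayashi–Sprung dictionary `b = −κ₀ · BSDquot(E₂) · log_ω(P₂)² / m₂₁` says the missing factor is the
SQUARE CLASS of the 2-adic formal logarithm of a generator `P₂` of `E₂(ℚ)` (odd squares are 1 or 9
mod 16).  TEST (D-an-42s, kit j341102, `job47/engine47.py`: PARI `ellpadiclog` on `2P₂ ∈ E₂,₁(ℚ₂)`
and, independently, the formal-group log series to 400 terms — the two agree on 954/954): on ALL 954
rows with a generator on file (E₂ = minimal model of the twist by 2, #E₂(ℚ)_tors = 1, #Ш_an(E₂) = 1,
generator saturated at primes ≤ 1000)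
`unit(b) · m₂₁ ≡ −2 · Tam(E₂)_odd · (log_ω(P₂)_unit)²  (mod 32)`  — 954/954, 0 exceptions
(raw statistic 482 : 472 before dividing by the log's square class; a₂ = −2: 244, 0: 465, +2: 245),
i.e. the dictionary holds to FIVE bits with `κ₀ ≡ 1 (mod 16)` in tree units and NO further local
factor; the ω_E-versus-ω_{E₂} normalisation is immaterial here (the twisting isomorphism over
`ℚ(√2)` scales ω by `u` with `u² = 32·(odd ≡ 1 mod 16)` on 954/954).

`FlatBlindUnitLogSquareAtChi8` types this for an ARBITRARY rational point `P` of infinite order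
(index `ι = [E₂(ℚ) : ℤP]`, so `#Ш·Tam·log(gen)²/#tors² = #Ш·Tam·log(P)²/ι²` — torsion-free form) read
in `E₂(ℚ₂)` through the tree's `padicPointOf`, pushed into `E₂,₁(ℚ₂)` by the tree's `formalIndex m₀`
(`log(m₀P) = m₀ log P`), with the tree's `padicLogPoint` (AEC IV.6.4 / VII.2.2) and the algebraic
`shaOrder` (finite for analytic rank 1 by Gross–Zagier–Kolyvagin; the hypothesis `shaOrder ≠ 0` only
removes the `Nat.card` junk value).  Evidence regime: ι = 2 (P = 2·generator), tors = 1, Ш = 1.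
Why novel: no printed statement gives the 2-adic unit of a supersingular ± / ♯♭ leading term beyond
its valuation at p = 2; here five bits are identified, the fifth as a global square class.
Cheapest falsifier: one certified row with `val₁₆·(m₂₁/2)·(log unit)⁻² ≢ 15 (mod 16)` — none in 954.
-/

noncomputable section

open scoped Classical MatrixGroups ModularForm

open PowerSeries WeierstrassCurve CongruenceSubgroup Literature.NumberTheory.EllipticCurves
  Literature.NumberTheory.EllipticCurves.ModularForms Literature.NumberTheory.EllipticCurves.Sprung2017
  Literature.NumberTheory.EllipticCurves.Rank1Residual
  Summit.BirchSwinnertonDyer.Rank1Residual.Supersingular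
  Summit.BirchSwinnertonDyer.Rank1Residual.Supersingular.BlindLever

namespace Summit.BirchSwinnertonDyer.Cruxes.RankOneAtTwoBigImageOddLocal.BlindUnitAN56

/-! Mirror of the three Katz-column definitions of `BlindFlatUnitKatzAN55` (same text; that crux
workfile — commit 8d956abac144 — is not yet in the farm snapshot, so it cannot be imported here). -/

/-- `f₂ = ∫η` regularised: `Σ_{N ≥ 1} (d(N)/N) z^N`, `d(N) = coeff (N+1) (z²x(z)·ω(z)/dz)`.
[Katz 1981 §5] [folklore] -/
def formalEtaIntegral {A : Type*} [CommRing A] [Algebra ℚ A] (V : WeierstrassCurve A) : A⟦X⟧ :=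
  PowerSeries.mk fun N =>
    if N = 0 then 0 else algebraMap ℚ A (1 / (N : ℚ)) * coeff (N + 1) (V.formalXMulSq * V.formalOmega)

/-- The Frobenius lift `f(z) ↦ f(z²)`. [Katz 1981 §3] [folklore] -/
def frobTwo {A : Type*} [CommRing A] (g : A⟦X⟧) : A⟦X⟧ :=
  PowerSeries.mk fun n => if 2 ∣ n then coeff (n / 2) g else 0

/-- `2`-adic integrality of a power series over `ℚ_[2]`. [folklore] -/
def IsTwoAdicIntegral (g : ℚ_[2]⟦X⟧) : Prop := ∀ n : ℕ, ‖coeff n g‖ ≤ 1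

/-- Katz's first Frobenius column `(m₁₁, m₂₁)` of `φ` on `D(Ê)` in the basis `(ω, η)`:
`F(log_V) − m₁₁·log_V − m₂₁·f₂` is `2`-integral. [Katz 1981 §5 / ASD congruences] [folklore] -/
def IsKatzFrobeniusColumn (V : WeierstrassCurve ℚ_[2]) (m₁₁ m₂₁ : ℤ_[2]) : Prop :=
  IsTwoAdicIntegral
    (frobTwo V.formalLog - C (m₁₁ : ℚ_[2]) * V.formalLog - C (m₂₁ : ℚ_[2]) * formalEtaIntegral V)

/-- **P-an-42E (conjecture; 954/954 certified rows, kit j341036 × j341102).**  In the setting of LAW 42C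
(`E/ℚ` globally minimal, good supersingular at 2, blind sign `w(E)·χ₈(N) = −1`, Sprung pair `(Ls, Lf)`,
`E₂` = a globally minimal model of the twist by 2 with analytic rank 1, `(m₁₁, m₂₁)` the first column
of the Katz Frobenius at 2 of `E`, `b = evalAt (−2) Lf = u·2ⁿ`): for every rational point `P` of `E₂`
of finite index `ι = [E₂(ℚ) : ℤP] ≠ 0`, writing `log_W(z(m₀ • P)) = w · 2^e` (`w ∈ ℤ₂ˣ`,
`m₀ = formalIndex E₂ 2`),
`u · m₂₁ · ι_odd² · (m₀)_odd² ≡ −2 · Tam(E₂)_odd · #Ш(E₂)_odd · w²  (mod 32)`.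
[evidence: CensusAN43 §8 + census44 (job47); a₂-uniform; implies LAW 42C mod 16 since odd squares
are ≡ 1 (mod 8) and `#Ш_odd` is a square] -/
@[conjecture] def FlatBlindUnitLogSquareAtChi8 : Prop :=
  ∀ (W : WeierstrassCurve ℚ) [W.IsElliptic] [W.IsGloballyMinimal] [NeZero (W.conductorNorm ℤ)]
    (f : CuspForm (Gamma0 (W.conductorNorm ℤ)) 2), IsNewformOf W f → GoodSS W 2 →
    W.rootNumber * ZMod.χ₈ (W.conductorNorm ℤ : ZMod 8) = -1 →
    ∀ (Ls Lf : IwasawaAlgebra 2), IsSprungPair f 2 (W.frobeniusTrace 2) Ls Lf →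
    ∀ (W₂ : WeierstrassCurve ℚ) [W₂.IsElliptic] [W₂.IsGloballyMinimal],
      (∃ C : WeierstrassCurve.VariableChange ℚ, C • W.quadraticTwist 2 = W₂) →
      W₂.analyticRank = 1 → W₂.shaOrder ≠ 0 →
    ∀ (m₁₁ m₂₁ : ℤ_[2]), IsKatzFrobeniusColumn (W.map (Rat.castHom ℚ_[2])) m₁₁ m₂₁ →
    ∀ (u : ℤ_[2]ˣ) (n : ℕ), evalAt (-2 : ℤ_[2]) Lf = (u : ℤ_[2]) * 2 ^ n →
    ∀ (P : (W₂.baseChange ℚ).toAffine.Point) (ι : ℕ),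
      (AddSubgroup.zmultiples P).index = ι → ι ≠ 0 →
    ∀ (w : ℤ_[2]ˣ) (e : ℤ),
      (W₂.baseChange ℚ_[2]).padicLogPoint
          (formalIndex W₂ 2 • padicPointOf W₂ 2 (Rat.castHom ℚ_[2]) P) = (w : ℤ_[2]) * (2 : ℚ_[2]) ^ e →
      PadicInt.toZModPow 5 ((u : ℤ_[2]) * m₂₁)
          * ((ι / 2 ^ padicValNat 2 ι : ℕ) : ZMod (2 ^ 5)) ^ 2
          * ((formalIndex W₂ 2 / 2 ^ padicValNat 2 (formalIndex W₂ 2) : ℕ) : ZMod (2 ^ 5)) ^ 2 =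
        -2 * ((W₂.tamagawaProduct / 2 ^ padicValNat 2 W₂.tamagawaProduct : ℕ) : ZMod (2 ^ 5))
          * ((W₂.shaOrder / 2 ^ padicValNat 2 W₂.shaOrder : ℕ) : ZMod (2 ^ 5))
          * PadicInt.toZModPow 5 (w : ℤ_[2]) ^ 2

/-- Kernel check of the square-class arithmetic behind P-an-42E ⇒ LAW 42C: an odd residue mod 16
squares to 1 or 9, so multiplying an EVEN residue by an odd square does not change it mod 16. -/
theorem odd_sq_mod_sixteen : ∀ s : ZMod 16, (¬ 2 ∣ s.val) → (s * s = 1 ∨ s * s = 9) := by decide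

theorem even_mul_odd_sq_mod_sixteen : ∀ a s : ZMod 16, 2 ∣ a.val → ¬ 2 ∣ s.val → a * (s * s) = a := by
  decide

end Summit.BirchSwinnertonDyer.Cruxes.RankOneAtTwoBigImageOddLocal.BlindUnitAN56

end
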